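import Summits.NavierStokesRegularity.NavierStokesRegularity.Theorems.ScenarioCensusTemporalSpectrumExponential
import Summits.NavierStokesRegularity.NavierStokesRegularity.Theorems.ScenarioCensusModeRankShell
import HarnessLib

/-!
# LINE «temporal-spectrum» port, part 3/12: §H the oscillatory cell — lemmas (`nonpos_of_mul_le_laplacian`, `eq_zero_of_laplacian_pair`, trigonometric times) and `Row_A1cx`

Re-homed for the scenario census (typer seat ns-census-typer-1 g8; the cells A1ex / A1po are MEMBERS OF RECORD «DECIDED IN KERNEL IN FILES» of row A1apT since census
v1.69 and A1jb / A1cs / A1qx / A1cx since v1.71 (critic idea-crit-3 g6 PASS — no price 20:33:05Z, RE-STAMPs REV 2 → REV 3 → REV 4 22:13:50Z; ref ns-census-ref g8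
PRE-CHECK ✓ §13.14 item 11 + items 19/20; lit §21.21 / §21.24 (a)); this port makes them TREE-decided): VERBATIM PORT of ns-idea-2 LINE g12-2 «temporal-spectrum»
REV 4, `pub/ideators/ns-idea-2/lines/temporal-spectrum/line-temporal-spectrum.lean` sha16 f2331f3a0765e1d4 (3431 l., lean check rc 0, 0 sorry), split for the
400-line rule into twelve parts `ScenarioCensusTemporalSpectrum{∅, Exponential, Oscillatory, OscillatoryRow, Jordan, Complex, ComplexDecay, ComplexRow, Quasi, QuasiGroup,
QuasiRow, Head}` (chain imports).  Lean text VERBATIM in namespace `…Theorems.ScenarioCensus.TemporalSpectrum` (the line's `…Lines.TemporalSpectrum` re-homed);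
port edits: the two `local notation "E3"` lines → one `abbrev E3` at namespace level and the bracket lines `section Rows` / `end Rows` dropped (no `variable`s
there; typer lint: no notation in port files), `@[conjecture]` on the OPEN head `Row_A1qp` (typed only), twenty-one one-line docstrings added (gate lint); the
lemmas the line shares VERBATIM with «mode-rank» / «floquet-meter» (§B spatial Liouville lemmas, the instrument `vortB` / `vortB_sum_sum`, the gauge
`tendsto_slice_atBot` / `eq_zero_of_curl_slice_const`, `laplacian_zero_apply`, `norm_curl_le_four_mul`) are taken BY NAME from those landed ports (listed
below); `tendsto_typeI_bound` (twin of a landed tree lemma in a module the farm does not build) is not re-declared and its four uses carry the one-line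
Mathlib proof inline (proof text only).  Statements untouched.

No census VALUE is moved here (row A1apT keeps its value; the members become TREE-decided by name); NS regularity is NOT proved; (L′) ⟨10661⟩ is
untouched; no summit statement is proved by this file. Lemmas that restate already-landed tree declarations are taken BY NAME (gate lint `dedup.landed`): `apply_eq_apply_of_harmonic_bounded` = `ModeRank.apply_eq_apply_of_harmonic_bounded`, `apply_eq_apply_of_curl_const` = `ModeRank.apply_eq_apply_of_curl_const`, `nonpos_of_laplacian_eq_mul` = `ModeRank.nonpos_of_laplacian_eq_mul`, `eq_zero_of_laplacian_eq_smul_of_pos` = `ModeRank.eq_zero_of_laplacian_eq_smul_of_pos`, `vortB` = `ModeRank.vortB`, `vortB_sum_sum` = `ModeRank.vortB_sum_sum`, `tendsto_slice_atBot` = `ModeRank.tendsto_slice_atBot`, `eq_zero_of_curl_slice_const` = `ModeRank.eq_zero_of_curl_slice_const`, `laplacian_zero_apply` = `ModeRank.laplacian_zero_fun`, `norm_curl_le_four_mul` = `FloquetMeter.norm_curl_le_four_mul`.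
-/

-- the summit and its single problem share the name `NavierStokesRegularity` (D-0017 nested layout)
set_option linter.dupNamespace false

noncomputable section

open Set Function Filter Topology

namespace Summit.NavierStokesRegularity.NavierStokesRegularity.Theorems.ScenarioCensus.TemporalSpectrum

open Literature.Analysis Literature.Analysis.FluidPDE InnerProductSpace
open Summit.NavierStokesRegularity.NavierStokesRegularity.Theorems (vorticity_eq_deriv_of_typeI)
open scoped Laplacian InnerProductSpace RealInnerProductSpace ContDiff

/-! ## H. The oscillatory cell: one complex-conjugate pair of rates `a ± ib`

This is the card's own "cheapest falsifier" row, decided in kernel: a time-OSCILLATING mode pair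
`u(t,x) = e^{at}(cos(bt) ψ(x) + sin(bt) χ(x))`, `b ≠ 0`.  Lever: for `a ≤ 0` Type-I decay along the
lattice of times where `(cos bt, sin bt) = (1,0)` resp. `(0,-1)`; for `a > 0` the vorticity identity is
`e^{at} V(t) + e^{2at} W(t) = 0` with `V, W` trigonometric, hence `2π/b`-PERIODIC, while the weights
`e^{at}`, `e^{2at}` are not — comparing `t` with `t - 2π/b` separates `V ≡ 0`, `W ≡ 0` (a Floquet-type
separation replacing dominant balance); `V ≡ 0` is the ROTATING SHELL SYSTEM
`Δω_ψ = aω_ψ + bω_χ`, `Δω_χ = aω_χ - bω_ψ`, whose bounded solutions vanish because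
`|ω_ψ|² + |ω_χ|²` is a bounded subsolution `Δf ≥ 2a f` (tree `laplacian_inner_self_eq` + the
max-principle barrier); then the KNSS gauge. -/

/-- Subsolution form of the positive-shell Liouville lemma (maximum principle with the barrier
`δ‖x‖²`): a `C²` function bounded above with `μ f ≤ Δ f`, `μ > 0`, is `≤ 0`. -/
theorem nonpos_of_mul_le_laplacian {f : E3 → ℝ} (hf : ContDiff ℝ 2 f) {μ : ℝ} (hμ : 0 < μ)
    (hΔ : ∀ x, μ * f x ≤ (Δ f) x) {A : ℝ} (hA : ∀ x, f x ≤ A) (y : E3) : f y ≤ 0 := by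
  by_contra hy
  push Not at hy
  have hden : 0 < ‖y‖ ^ 2 + 6 / μ := by positivity
  set δ : ℝ := f y / (2 * (‖y‖ ^ 2 + 6 / μ)) with hδ
  have hδ0 : 0 < δ := by positivity
  set h : E3 → ℝ := fun x => f x - δ * ‖x‖ ^ 2 with hh
  have hcont : Continuous h := hf.continuous.sub (continuous_const.mul (continuous_norm.pow 2))
  have h0 : h 0 = f 0 := by simp [hh]
  have hev : ∀ᶠ x in cocompact E3, h x ≤ h 0 := by
    have hR := (tendsto_norm_cocompact_atTop (E := E3)).eventually
      (eventually_ge_atTop (max 1 ((A - f 0) / δ)))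
    filter_upwards [hR] with x hx
    have hx1 : 1 ≤ ‖x‖ := (le_max_left _ _).trans hx
    have hx2 : (A - f 0) / δ ≤ ‖x‖ := (le_max_right _ _).trans hx
    have hx3 : (A - f 0) / δ ≤ ‖x‖ ^ 2 := hx2.trans (by nlinarith)
    have hx4 : A - f 0 ≤ δ * ‖x‖ ^ 2 := by
      rw [div_le_iff₀ hδ0] at hx3; linarith
    rw [h0]
    show f x - δ * ‖x‖ ^ 2 ≤ f 0
    linarith [hA x]
  obtain ⟨x₀, hx₀⟩ := hcont.exists_forall_ge' 0 hev
  have hmax : IsLocalMax h x₀ := Filter.Eventually.of_forall fun z => hx₀ z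
  have hn2 : ContDiff ℝ 2 (fun w : E3 => ‖w‖ ^ 2) := contDiff_norm_sq ℝ
  have hh2 : ContDiff ℝ 2 h := hf.sub (contDiff_const.mul hn2)
  have hΔh : (Δ h) x₀ = (Δ f) x₀ - δ * 6 := by
    have e1 : h = f - δ • (fun w : E3 => ‖w‖ ^ 2) := by
      funext z; simp [hh]
    have hs : ContDiffAt ℝ 2 (δ • fun w : E3 => ‖w‖ ^ 2) x₀ :=
      (show ContDiff ℝ 2 (δ • fun w : E3 => ‖w‖ ^ 2) from hn2.const_smul δ).contDiffAt
    rw [e1, hf.contDiffAt.laplacian_sub hs, InnerProductSpace.laplacian_smul δ hn2.contDiffAt,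
      Literature.Analysis.PDE.PoissonBall.laplacian_norm_sq, finrank_euclideanSpace_fin]
    simp only [smul_eq_mul]
    push_cast
    ring
  have hle : (Δ h) x₀ ≤ 0 := laplacian_nonpos_of_isLocalMax hh2 hmax
  have hfx : μ * f x₀ ≤ 6 * δ := by linarith [hΔ x₀]
  have h2 : f y - δ * ‖y‖ ^ 2 ≤ f x₀ := by
    have := hx₀ y
    simp only [hh] at this
    nlinarith [sq_nonneg ‖x₀‖]
  have h3 : μ * (f y - δ * ‖y‖ ^ 2) ≤ 6 * δ :=
    (mul_le_mul_of_nonneg_left h2 hμ.le).trans hfx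
  have h4 : μ * f y = 2 * δ * μ * ‖y‖ ^ 2 + 12 * δ := by
    rw [hδ]; field_simp; ring
  have h6 : 0 ≤ δ * μ * ‖y‖ ^ 2 := by positivity
  nlinarith

/-- **No bounded solutions of the rotating shell system.**  If bounded `C²` fields `p q : ℝ³ → ℝ³`
satisfy `Δ p = a p + b q`, `Δ q = a q - b p` with `a > 0`, then `p = q = 0`: the function
`f = |p|² + |q|²` is bounded and `Δ f = 2a f + 2|∇p|² + 2|∇q|² ≥ 2a f` (the `b`-terms cancel). -/
theorem eq_zero_of_laplacian_pair {p q : E3 → E3} (hp : ContDiff ℝ 2 p) (hq : ContDiff ℝ 2 q)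
    {a b : ℝ} (ha : 0 < a) (hΔp : ∀ x, (Δ p) x = a • p x + b • q x)
    (hΔq : ∀ x, (Δ q) x = a • q x - b • p x) {A B : ℝ} (hA : ∀ x, ‖p x‖ ≤ A)
    (hB : ∀ x, ‖q x‖ ≤ B) : p = 0 ∧ q = 0 := by
  have hfp : ContDiff ℝ 2 (fun x => ⟪p x, p x⟫) := hp.inner ℝ hp
  have hfq : ContDiff ℝ 2 (fun x => ⟪q x, q x⟫) := hq.inner ℝ hq
  set f : E3 → ℝ := fun x => ⟪p x, p x⟫ + ⟪q x, q x⟫ with hf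
  have hf2 : ContDiff ℝ 2 f := hfp.add hfq
  have hfe : f = (fun x => ⟪p x, p x⟫) + fun x => ⟪q x, q x⟫ := rfl
  have hΔf : ∀ x, (2 * a) * f x ≤ (Δ f) x := by
    intro x
    rw [hfe, hfp.contDiffAt.laplacian_add hfq.contDiffAt, laplacian_inner_self_eq hp x,
      laplacian_inner_self_eq hq x, hΔp x, hΔq x]
    simp only [Pi.add_apply, inner_add_left, inner_sub_left, real_inner_smul_left]
    rw [real_inner_comm (p x) (q x)]
    nlinarith [frobeniusNormSq_nonneg (fderiv ℝ p x), frobeniusNormSq_nonneg (fderiv ℝ q x)]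
  have hbound : ∀ x, f x ≤ A ^ 2 + B ^ 2 := by
    intro x
    simp only [hf, real_inner_self_eq_norm_sq]
    nlinarith [pow_le_pow_left₀ (norm_nonneg _) (hA x) 2,
      pow_le_pow_left₀ (norm_nonneg _) (hB x) 2]
  have hμ : 0 < 2 * a := by positivity
  have hnp : ∀ y, f y ≤ 0 := nonpos_of_mul_le_laplacian hf2 hμ hΔf hbound
  have hzero : ∀ y, p y = 0 ∧ q y = 0 := by
    intro y
    have h1 := hnp y
    simp only [hf, real_inner_self_eq_norm_sq] at h1
    have hp0 : ‖p y‖ ^ 2 = 0 := by nlinarith [sq_nonneg ‖p y‖, sq_nonneg ‖q y‖]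
    have hq0 : ‖q y‖ ^ 2 = 0 := by nlinarith [sq_nonneg ‖p y‖, sq_nonneg ‖q y‖]
    exact ⟨norm_eq_zero.1 (pow_eq_zero_iff two_ne_zero |>.1 hp0),
      norm_eq_zero.1 (pow_eq_zero_iff two_ne_zero |>.1 hq0)⟩
  exact ⟨funext fun y => (hzero y).1, funext fun y => (hzero y).2⟩

/-- Time derivative of a finite mode sum with differentiable scalar coefficients. -/
theorem hasDerivAt_sum_smul {n : ℕ} {c : ℝ → Fin n → ℝ} {c' : Fin n → ℝ} (v : Fin n → E3) {t : ℝ}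
    (hc : ∀ k, HasDerivAt (fun s => c s k) (c' k) t) :
    HasDerivAt (fun s => ∑ k, c s k • v k) (∑ k, c' k • v k) t :=
  HasDerivAt.fun_sum fun k _ => (hc k).smul_const (v k)

/-- Far-past times on the lattice `cos (b s) = 1`, `sin (b s) = 0`. -/
theorem exists_le_cos_eq_one {b : ℝ} (hb : 0 < b) (T : ℝ) :
    ∃ s : ℝ, s ≤ T ∧ s < 0 ∧ Real.cos (b * s) = 1 ∧ Real.sin (b * s) = 0 := by
  obtain ⟨n, hn⟩ : ∃ n : ℕ, (max (-T) 1) * b / (2 * Real.pi) < n := exists_nat_gt _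
  have hπ := Real.pi_pos
  have hn1 : 0 < (n : ℝ) := lt_of_le_of_lt (by positivity) hn
  refine ⟨-(n * (2 * Real.pi)) / b, ?_, ?_, ?_, ?_⟩
  · have h1 : max (-T) 1 * b < n * (2 * Real.pi) := by
      rwa [div_lt_iff₀ (by positivity)] at hn
    have h2 : -T ≤ max (-T) 1 := le_max_left _ _
    rw [div_le_iff₀ hb]
    nlinarith
  · rw [div_lt_iff₀ hb]; nlinarith
  · rw [mul_div_cancel₀ _ hb.ne', Real.cos_neg, Real.cos_nat_mul_two_pi]
  · rw [mul_div_cancel₀ _ hb.ne', Real.sin_neg]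
    simpa using Real.sin_nat_mul_two_pi_sub 0 n

/-- Far-past times on the lattice `cos (b s) = 0`, `sin (b s) = -1`. -/
theorem exists_le_sin_eq_neg_one {b : ℝ} (hb : 0 < b) (T : ℝ) :
    ∃ s : ℝ, s ≤ T ∧ s < 0 ∧ Real.cos (b * s) = 0 ∧ Real.sin (b * s) = -1 := by
  obtain ⟨n, hn⟩ : ∃ n : ℕ, (max (-T) 1) * b / (2 * Real.pi) < n := exists_nat_gt _
  have hπ := Real.pi_pos
  have hn1 : 0 < (n : ℝ) := lt_of_le_of_lt (by positivity) hn
  refine ⟨-(Real.pi / 2 + n * (2 * Real.pi)) / b, ?_, ?_, ?_, ?_⟩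
  · have h1 : max (-T) 1 * b < n * (2 * Real.pi) := by
      rwa [div_lt_iff₀ (by positivity)] at hn
    have h2 : -T ≤ max (-T) 1 := le_max_left _ _
    rw [div_le_iff₀ hb]
    nlinarith
  · rw [div_lt_iff₀ hb]; nlinarith
  · rw [mul_div_cancel₀ _ hb.ne', Real.cos_neg, Real.cos_add_nat_mul_two_pi, Real.cos_pi_div_two]
  · rw [mul_div_cancel₀ _ hb.ne', Real.sin_neg, Real.sin_add_nat_mul_two_pi, Real.sin_pi_div_two]

/-- **Row A1cx (one oscillatory mode pair, rates `a ± ib`)** — census A-block cell, (L′)-shape over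
the genuine class `IsTypeIAncientMild C u` BY NAME: if on `t < 0`
`u(t, x) = e^{a t} (cos(b t) ψ(x) + sin(b t) χ(x))` with `b ≠ 0` and `C³` fields `ψ, χ` with bounded
curls, then `u ≡ 0` on `t < 0`.  (For `b = 0` this is the one-mode case of `Row_A1ex`.) -/
def Row_A1cx : Prop :=
  ∀ (C : ℝ) (u : ℝ → E3 → E3), IsTypeIAncientMild C u →
    ∀ (a b : ℝ) (ψ χ : E3 → E3), b ≠ 0 → ContDiff ℝ 3 ψ → ContDiff ℝ 3 χ →
      (∃ A : ℝ, ∀ x, ‖curl ψ x‖ ≤ A) → (∃ A : ℝ, ∀ x, ‖curl χ x‖ ≤ A) →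
      (∀ t < 0, ∀ x, u t x =
        Real.exp (a * t) • (Real.cos (b * t) • ψ x + Real.sin (b * t) • χ x)) →
      ∀ t < 0, ∀ x, u t x = 0

end Summit.NavierStokesRegularity.NavierStokesRegularity.Theorems.ScenarioCensus.TemporalSpectrum

end
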